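import Summits.AtomisticToContinuum.BoseEinsteinCondensation.Theorems.BECInsertionCorrectorCorrectorClosureSplit
import HarnessLib

/-!
# Census-s6 sketch (crux-strategist, family `-s`) — CorrectorClosure, item stmt-AtomisticToContinuum-12058

Kernel-checked bookkeeping for STRATEGY-CENSUS-s6.md:

* `PeriodicBECBody`  = child 1 of the landed split (item stmt-AtomisticToContinuum-8997, verbatim body);
* `TorusBECOfSRB`    = W := `StaticResponseBound → PeriodicBECBody`, the WEAKEST intermediate that the
  route's deciding theorem `closes` actually consumes from `CorrectorClosure` (`closes_of_W`);
* `InsertionResidueOfBEC` = child 2 of the landed split (removal-fidelity surplus);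
* `correctorClosure_iff_W_and_insertionResidueOfBEC` : the split is EXACT unconditionally
  (sharpening `correctorClosure_iff_of_staticResponseBound`, which assumed K1);
* `W_of_correctorClosure`, `W_iff_periodicBECBody_of_SRB` : W sits between the crux and item 8997.

No new mathematics; census evidence only. [folklore]
-/

open MeasureTheory Filter Matrix
open scoped ENNReal NNReal BigOperators ComplexConjugate

namespace Summit.AtomisticToContinuum.BoseEinsteinCondensation.Cruxes.CorrectorClosure.CensusS6

open Literature.MathematicalPhysics.QuantumManyBody.BoseGas
open Summit.AtomisticToContinuum.BoseEinsteinCondensation.Theses.BECInsertionCorrector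

/-- Torus BEC of near-minimisers for one potential `v` (the body of item 8997 at `v`). -/
def PeriodicBECAt (v : ℝ → ℝ≥0∞) : Prop :=
  ∃ ρ₀ : ℝ, 0 < ρ₀ ∧ ∀ ρ : ℝ, 0 < ρ → ρ < ρ₀ → ∃ c : ℝ, 0 < c ∧ ∀ᶠ N : ℕ in Filter.atTop,
    ∃ δ : ℝ≥0∞, 0 < δ ∧ ∀ Ψ : PeriodicTrialState N (sideLength ρ N),
      periodicEnergy v Ψ ≤ periodicGroundStateEnergy v N (sideLength ρ N) + δ →
      ENNReal.ofReal (c * N) ≤ condensateOccupation N (sideLength ρ N) Ψ.ψ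

/-- Insertion-residue floor for one potential `v` (the body of the route target at `v`). -/
def InsertionResidueAt (v : ℝ → ℝ≥0∞) : Prop :=
  ∃ ρ₀ : ℝ, 0 < ρ₀ ∧ ∀ ρ : ℝ, 0 < ρ → ρ < ρ₀ → ∃ c : ℝ, 0 < c ∧ ∀ᶠ N : ℕ in Filter.atTop,
    ∃ δ : ℝ≥0∞, 0 < δ ∧ ∃ Θ : PeriodicTrialState N (sideLength ρ (N + 1)),
      periodicEnergy v Θ ≤ periodicGroundStateEnergy v N (sideLength ρ (N + 1)) + δ ∧
      ∀ Ψ : PeriodicTrialState (N + 1) (sideLength ρ (N + 1)),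
        periodicEnergy v Ψ ≤ periodicGroundStateEnergy v (N + 1) (sideLength ρ (N + 1)) + δ →
        ENNReal.ofReal c ≤ ENNReal.ofReal ((sideLength ρ (N + 1) ^ 3)⁻¹) *
          (‖∫ X in cellN N (sideLength ρ (N + 1)), conj (Θ.ψ X) *
              ∫ x in cell (sideLength ρ (N + 1)), Ψ.ψ (vecCons x X)‖₊ : ℝ≥0∞) ^ 2

/-- Child 1 of the landed split = item stmt-AtomisticToContinuum-8997 (torus BEC, all admissible `v`). -/
def PeriodicBECBody : Prop :=
  ∀ v : ℝ → ℝ≥0∞, IsRepulsiveFiniteRange v → PeriodicBECAt v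

/-- **W** — the weakest intermediate the route's `closes` consumes from the crux:
torus BEC of near-minimisers CONDITIONAL on the static response bound K1. -/
def TorusBECOfSRB : Prop :=
  StaticResponseBound → PeriodicBECBody

/-- Child 2 of the landed split: given K1, torus BEC at `v` implies the insertion-residue floor at `v`
(the removal-fidelity surplus of the crux over W). -/
def InsertionResidueOfBEC : Prop :=
  StaticResponseBound → ∀ v : ℝ → ℝ≥0∞, IsRepulsiveFiniteRange v → PeriodicBECAt v → InsertionResidueAt v

/-- The route target is `∀ v adm, InsertionResidueAt v` (definitional). -/
theorem insertionResidue_iff : InsertionResidue ↔ ∀ v : ℝ → ℝ≥0∞, IsRepulsiveFiniteRange v →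
    InsertionResidueAt v := Iff.rfl

/-- The crux implies W (landed `ResidueCondenses_proof`, item 12059). -/
theorem W_of_correctorClosure (hCC : CorrectorClosure) : TorusBECOfSRB :=
  fun hK1 => Summit.AtomisticToContinuum.BoseEinsteinCondensation.Theorems.ResidueCondenses_proof (hCC hK1)

/-- **The route's deciding theorem needs only W from the crux**: same proof term as `closes` with
`h₃ (h₂ h₁)` replaced by `hW h₁`. So replacing `CorrectorClosure` by W would still decide the
sub-problem (a tenure-planner fact; this seat files no route edit). -/
theorem closes_of_W (h₁ : StaticResponseBound) (hW : TorusBECOfSRB) (h₄ : BoundaryTransferWeak) :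
    _root_.BoseEinsteinCondensation :=
  fun v hv => h₄ v hv (hW h₁ v hv)

/-- Under K1, W is literally item 8997. -/
theorem W_iff_periodicBECBody_of_SRB (hK1 : StaticResponseBound) : TorusBECOfSRB ↔ PeriodicBECBody :=
  ⟨fun hW => hW hK1, fun hP _ => hP⟩

/-- Without K1, W holds vacuously — so W is strictly about the K1-world. -/
theorem W_of_not_SRB (h : ¬ StaticResponseBound) : TorusBECOfSRB := fun hK1 => absurd hK1 h

/-- **Exact, unconditional split of the crux**: `CorrectorClosure ↔ W ∧ InsertionResidueOfBEC`
(sharpens the landed `correctorClosure_iff_of_staticResponseBound`, which carried K1 as a hypothesis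
and child 1 unconditionally). -/
theorem correctorClosure_iff_W_and_insertionResidueOfBEC :
    CorrectorClosure ↔ (TorusBECOfSRB ∧ InsertionResidueOfBEC) :=
  ⟨fun hCC => ⟨W_of_correctorClosure hCC, fun hK1 v hv _ => hCC hK1 v hv⟩,
    fun h hK1 v hv => h.2 hK1 v hv (h.1 hK1 v hv)⟩

/-- The two pieces recombine through the landed `CorrectorClosure_of_subs` as well (child 1 there is
`PeriodicBECBody` outright; W suffices because K1 is in scope inside the crux). -/
theorem correctorClosure_of_W_of_insertionResidueOfBEC (hW : TorusBECOfSRB)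
    (hB : InsertionResidueOfBEC) : CorrectorClosure :=
  fun hK1 => Summit.AtomisticToContinuum.BoseEinsteinCondensation.Theorems.CorrectorClosure.Split.CorrectorClosure_of_subs
    (hW hK1) hB hK1

/-- Negation bookkeeping: a counterexample to the crux is K1 together with either ¬(torus BEC) or
(torus BEC ∧ ¬ removal-fidelity surplus). -/
theorem not_correctorClosure_iff :
    ¬ CorrectorClosure ↔ (StaticResponseBound ∧ ¬ PeriodicBECBody) ∨
      (StaticResponseBound ∧ PeriodicBECBody ∧ ¬ InsertionResidueOfBEC) := by
  rw [correctorClosure_iff_W_and_insertionResidueOfBEC]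
  constructor
  · intro h
    by_cases hK1 : StaticResponseBound
    · by_cases hP : PeriodicBECBody
      · right
        refine ⟨hK1, hP, fun hB => h ⟨fun _ => hP, hB⟩⟩
      · left; exact ⟨hK1, hP⟩
    · exact absurd ⟨W_of_not_SRB hK1, fun h1 => absurd h1 hK1⟩ h
  · rintro (⟨hK1, hP⟩ | ⟨hK1, _, hB⟩) ⟨hW, hB'⟩
    · exact hP (hW hK1)
    · exact hB hB'

end Summit.AtomisticToContinuum.BoseEinsteinCondensation.Cruxes.CorrectorClosure.CensusS6
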